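import Mathlib
import HarnessLib
import Literature.Analysis.FluidPDE.VectorCalculus
import Summits.NavierStokesRegularity.NavierStokesRegularity.Theorems.ImplosionDoorTangentialCurlFreeTrivialityKinematics

/-!
# Route UnthreadedRigidityDoor · crux `UnthreadedRigidity` (stmt-NavierStokesRegularity-27585) ·
# LINE «jet rigidity» — stub (a) `stub_sphericalMomentumDegenerate` (S–M, kinematic), PROVED

Seat ns-in-wu-con g2 (DIRECTOR-NS #219), `--supports stmt-NavierStokesRegularity-27585 --as helper`.
Registered skeleton of record: planner ns-idea-6 g5, `UnthreadedRigidity_jet_birth.lean`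
(sha16 `5d320f85a8de9ffc`, namespace `…Cruxes.UnthreadedRigidity.JetRigidity`); this file proves its
stub `StubSphericalMomentumDegenerate` VERBATIM (the def is restated — a Theorems file cannot import the
planner's HOME skeleton):

  a smooth divergence-free field `w` on `ℝ³`, unthreaded about `x₀` (`⟪curl w, x − x₀⟫ ≡ 0`) whose radial
  momentum `m(x) = ⟪w(x), x − x₀⟫` is SPHERICALLY SYMMETRIC about `x₀`, vanishes identically.

PROOF. Translate to `x₀ = 0` (`w₀ = w(· + x₀)`; `div`, `curl` commute with translations, `fderiv_comp_add_right`).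
(1) WEAK FLUX: for a `C¹` radial weight `K = k(|y|²)` of compact support, `∫ div(K w₀) = 0`
(tree `…TangentialCurlFreeTrivialityKinematics.integral_divergence_eq_zero`) and
`div(K w₀) = K div w₀ + 2k'(|y|²)⟪w₀, y⟫ = 2k'(|y|²) m(y)`.  By spherical symmetry `m(y) = G(|y|²)` with
`G(s) = m(√s e)` continuous; choosing `k' = b·G` with `b` a smooth bump around `s₀ = |y₀|² > 0` supported in
`(0,∞)` (`k(s) = ∫_{2s₀}^{s} bG`, which vanishes for large `s`) gives `∫ 2 b(|y|²) G(|y|²)² dy = 0`, so the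
continuous non-negative integrand vanishes and `m(y₀) = G(s₀) = 0`: `w₀` is SPHERE-TANGENTIAL.
(2) KINEMATIC RIGIDITY (tree `…Kinematics.eq_zero_of_tangential_divFree_radialCurlFree`, landed for
ImplosionDoor item 25306: harmonic 1-forms on `S²` vanish, via Bochner's identity in ambient coordinates):
sphere-tangential + divergence-free + zero radial vorticity ⇒ `w₀ = 0`.

HONEST FRAMING: a kinematic lemma feeding the DEGENERATE branch of the composition `UnthreadedRigidity_of`
of a DRAFT door route about HYPOTHETICAL blow-up profiles; the line's wall `stub_shearedRigidity` is OPEN;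
nothing here bears on `UnthreadedRigidity`, on the door Target, or on Navier–Stokes regularity; no summit
statement is proved. [folklore; cite: Backus1958 (Ann. Phys. 4, 372–447), §2 (poloidal–toroidal kinematics)]
-/

noncomputable section

set_option linter.dupNamespace false

namespace Summit.NavierStokesRegularity.NavierStokesRegularity.Cruxes.UnthreadedRigidity.JetRigidity

open MeasureTheory Set Function Filter Metric
open scoped Topology RealInnerProductSpace InnerProductSpace ContDiff
open Literature.Analysis.FluidPDE
open Summit.NavierStokesRegularity.NavierStokesRegularity.Theorems.ImplosionDoorTangentialCurlFreeTrivialityKinematics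
open Summit.NavierStokesRegularity.NavierStokesRegularity.Theorems.ImplosionDoorTangentialCurlFreeTrivialityBochner

/-- STUB 3 statement (S–M, kinematic): spherically symmetric radial momentum + unthreaded + div-free ⇒ the slice is 0. -/
def StubSphericalMomentumDegenerate : Prop :=
  ∀ (w : EuclideanSpace ℝ (Fin 3) → EuclideanSpace ℝ (Fin 3)) (x₀ : EuclideanSpace ℝ (Fin 3)),
    ContDiff ℝ (⊤ : ℕ∞) w → Literature.Analysis.FluidPDE.VectorCalculus.IsDivFree w →
    (∀ x, ⟪Literature.Analysis.FluidPDE.curl w x, x - x₀⟫_ℝ = 0) →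
    (∀ x x', ‖x - x₀‖ = ‖x' - x₀‖ → ⟪w x, x - x₀⟫_ℝ = ⟪w x', x' - x₀⟫_ℝ) →
    ∀ x, w x = 0

/-! ### The weak flux identity -/

/-- **Divergence of a radially weighted field**: `div (k(|y|²) U)(y) = k(|y|²) div U(y) + 2k'(|y|²)⟪U y, y⟫`.
[folklore] -/
theorem divergence_radialWeight_smul {k : ℝ → ℝ} (hk : Differentiable ℝ k)
    {U : EuclideanSpace ℝ (Fin 3) → EuclideanSpace ℝ (Fin 3)} (hU : Differentiable ℝ U)
    (y : EuclideanSpace ℝ (Fin 3)) :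
    VectorCalculus.divergence (fun z => k (‖z‖ ^ 2) • U z) y =
      k (‖y‖ ^ 2) * VectorCalculus.divergence U y + 2 * deriv k (‖y‖ ^ 2) * ⟪U y, y⟫ := by
  -- derivative of the weight
  have hK : HasFDerivAt (fun z : EuclideanSpace ℝ (Fin 3) => k (‖z‖ ^ 2))
      ((ContinuousLinearMap.toSpanSingleton ℝ (deriv k (‖y‖ ^ 2))).comp (2 • innerSL ℝ y)) y :=
    (hk (‖y‖ ^ 2)).hasDerivAt.hasFDerivAt.comp y (hasStrictFDerivAt_norm_sq y).hasFDerivAt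
  have hd : HasFDerivAt (fun z => k (‖z‖ ^ 2) • U z)
      (k (‖y‖ ^ 2) • fderiv ℝ U y +
        ((ContinuousLinearMap.toSpanSingleton ℝ (deriv k (‖y‖ ^ 2))).comp (2 • innerSL ℝ y)).smulRight
          (U y)) y :=
    hK.smul (hU y).hasFDerivAt
  unfold VectorCalculus.divergence
  rw [hd.fderiv, ContinuousLinearMap.toLinearMap_add, map_add, ContinuousLinearMap.toLinearMap_smul,
    map_smul, trace_smulRight, smul_eq_mul]
  simp only [ContinuousLinearMap.comp_apply, smul_apply,
    innerSL_apply_apply, ContinuousLinearMap.toSpanSingleton_apply, smul_eq_mul, real_inner_comm y]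
  ring

/-- **Weak flux identity**: for a `C¹` divergence-free field `U` and a `C¹` weight `k` with `k(s) = 0` for
`s ≥ R`, `∫ 2k'(|y|²)⟪U y, y⟫ dy = 0` (the divergence theorem for the compactly supported field `k(|y|²)U`).
[folklore] -/
theorem integral_radialWeight_flux_eq_zero {k : ℝ → ℝ} (hk : ContDiff ℝ 1 k) {R : ℝ}
    (hkR : ∀ s, R ≤ s → k s = 0)
    {U : EuclideanSpace ℝ (Fin 3) → EuclideanSpace ℝ (Fin 3)} (hU : ContDiff ℝ 1 U)
    (hdiv : ∀ y, VectorCalculus.divergence U y = 0) :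
    ∫ y, 2 * deriv k (‖y‖ ^ 2) * ⟪U y, y⟫ = 0 := by
  have hV1 : ContDiff ℝ 1 (fun z : EuclideanSpace ℝ (Fin 3) => k (‖z‖ ^ 2) • U z) :=
    (hk.comp (contDiff_norm_sq ℝ)).smul hU
  have hVc : HasCompactSupport (fun z : EuclideanSpace ℝ (Fin 3) => k (‖z‖ ^ 2) • U z) := by
    refine HasCompactSupport.intro (isCompact_closedBall (0 : EuclideanSpace ℝ (Fin 3)) (Real.sqrt |R|))
      fun z hz => ?_
    have hz' : Real.sqrt |R| < ‖z‖ := by simpa [mem_closedBall, dist_zero_right] using hz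
    have hRz : R ≤ ‖z‖ ^ 2 := by
      have h0 := mul_self_lt_mul_self (Real.sqrt_nonneg |R|) hz'
      rw [Real.mul_self_sqrt (abs_nonneg R)] at h0
      nlinarith [le_abs_self R]
    simp [hkR _ hRz]
  have h := Literature.Analysis.FluidPDE.integral_divergence_eq_zero hV1 hVc
  have e : (fun y => VectorCalculus.divergence (fun z : EuclideanSpace ℝ (Fin 3) => k (‖z‖ ^ 2) • U z) y) =
      fun y => 2 * deriv k (‖y‖ ^ 2) * ⟪U y, y⟫ := by
    funext y
    rw [divergence_radialWeight_smul (hk.differentiable one_ne_zero) (hU.differentiable one_ne_zero), hdiv y,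
      mul_zero, zero_add]
  rwa [e] at h

/-! ### Step 1: spherically symmetric radial momentum of a divergence-free field vanishes -/

/-- **Flux lemma.** A `C¹` divergence-free field on `ℝ³` whose radial momentum `⟪U y, y⟫` depends only on
`|y|` is sphere-tangential: `⟪U y, y⟫ = 0` for all `y` (the flux `4π r m(r)` through `S_r` is `∫_{B_r} div U
= 0`; here in the weak form `integral_radialWeight_flux_eq_zero` with the weight `k' = bump · m`). [folklore] -/
theorem inner_self_eq_zero_of_spherical {U : EuclideanSpace ℝ (Fin 3) → EuclideanSpace ℝ (Fin 3)}
    (hU : ContDiff ℝ 1 U) (hdiv : ∀ y, VectorCalculus.divergence U y = 0)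
    (hsym : ∀ y y' : EuclideanSpace ℝ (Fin 3), ‖y‖ = ‖y'‖ → ⟪U y, y⟫ = ⟪U y', y'⟫)
    (y₀ : EuclideanSpace ℝ (Fin 3)) : ⟪U y₀, y₀⟫ = 0 := by
  by_cases hy₀ : y₀ = 0
  · simp [hy₀]
  -- the profile `G` of the radial momentum: `⟪U y, y⟫ = G (|y|²)`
  set e : EuclideanSpace ℝ (Fin 3) := ‖y₀‖⁻¹ • y₀ with he
  have hne : ‖e‖ = 1 := by
    rw [he, norm_smul, norm_inv, norm_norm, inv_mul_cancel₀ (norm_ne_zero_iff.2 hy₀)]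
  set G : ℝ → ℝ := fun s => ⟪U (Real.sqrt s • e), Real.sqrt s • e⟫ with hG
  have hGc : Continuous G := by
    have h1 : Continuous fun s : ℝ => Real.sqrt s • e := Real.continuous_sqrt.smul continuous_const
    exact ((hU.continuous.comp h1).inner h1)
  have hmG : ∀ y : EuclideanSpace ℝ (Fin 3), ⟪U y, y⟫ = G (‖y‖ ^ 2) := by
    intro y
    refine hsym y _ ?_
    rw [norm_smul, Real.norm_eq_abs, abs_of_nonneg (Real.sqrt_nonneg _), hne, mul_one,
      Real.sqrt_sq (norm_nonneg _)]
  -- the bump around `s₀ = |y₀|² > 0`, supported in `(s₀/2, 3s₀/2) ⊂ (0, ∞)`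
  set s₀ : ℝ := ‖y₀‖ ^ 2 with hs₀
  have hs₀pos : 0 < s₀ := by positivity
  let b : ContDiffBump (s₀ : ℝ) := ⟨s₀ / 4, s₀ / 2, by positivity, by linarith⟩
  -- `h = b · G` and its primitive `k(s) = ∫_{2 s₀}^{s} h`
  set h : ℝ → ℝ := fun s => b s * G s with hh
  have hhc : Continuous h := b.continuous.mul hGc
  have hh0 : ∀ s, 3 * s₀ / 2 ≤ s → h s = 0 := by
    intro s hs
    have : (b : ℝ → ℝ) s = 0 := by
      apply ContDiffBump.zero_of_le_dist
      show s₀ / 2 ≤ dist s s₀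
      rw [Real.dist_eq, abs_of_nonneg (by linarith)]
      linarith
    simp [hh, this]
  set k : ℝ → ℝ := fun s => ∫ σ in (2 * s₀)..s, h σ with hk
  have hkd : ∀ s, HasDerivAt k (h s) s := fun s => (hhc.integral_hasStrictDerivAt (2 * s₀) s).hasDerivAt
  have hk' : deriv k = h := funext fun s => (hkd s).deriv
  have hk1 : ContDiff ℝ 1 k := by
    rw [contDiff_one_iff_deriv]
    exact ⟨fun s => (hkd s).differentiableAt, by rw [hk']; exact hhc⟩
  have hkR : ∀ s, 2 * s₀ ≤ s → k s = 0 := by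
    intro s hs
    have e0 : ∫ σ in (2 * s₀)..s, h σ = ∫ _σ in (2 * s₀)..s, (0 : ℝ) :=
      intervalIntegral.integral_congr fun σ hσ => by
        rw [uIcc_of_le hs] at hσ
        exact hh0 σ (by linarith [hσ.1])
    simp only [hk, e0, intervalIntegral.integral_zero]
  -- the weak flux identity with this weight: `∫ 2 b(|y|²) G(|y|²)² = 0`
  have hflux := integral_radialWeight_flux_eq_zero hk1 hkR hU hdiv
  have e2 : (fun y : EuclideanSpace ℝ (Fin 3) => 2 * deriv k (‖y‖ ^ 2) * ⟪U y, y⟫) =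
      fun y => 2 * (b (‖y‖ ^ 2) * G (‖y‖ ^ 2) ^ 2) := by
    funext y; rw [hk', hmG y]; simp only [hh]; ring
  rw [e2, integral_const_mul, mul_eq_zero] at hflux
  have hint0 : ∫ y : EuclideanSpace ℝ (Fin 3), b (‖y‖ ^ 2) * G (‖y‖ ^ 2) ^ 2 = 0 := by
    rcases hflux with h2 | h2
    · norm_num at h2
    · exact h2
  -- the integrand is continuous, non-negative and compactly supported, hence zero everywhere
  have hFc : Continuous fun y : EuclideanSpace ℝ (Fin 3) => b (‖y‖ ^ 2) * G (‖y‖ ^ 2) ^ 2 :=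
    (b.continuous.comp (continuous_norm.pow 2)).mul ((hGc.comp (continuous_norm.pow 2)).pow 2)
  have hFnn : ∀ y : EuclideanSpace ℝ (Fin 3), 0 ≤ b (‖y‖ ^ 2) * G (‖y‖ ^ 2) ^ 2 := fun y =>
    mul_nonneg (b.nonneg) (sq_nonneg _)
  have hFsupp : HasCompactSupport fun y : EuclideanSpace ℝ (Fin 3) => b (‖y‖ ^ 2) * G (‖y‖ ^ 2) ^ 2 := by
    refine HasCompactSupport.intro (isCompact_closedBall (0 : EuclideanSpace ℝ (Fin 3)) (Real.sqrt (2 * s₀)))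
      fun z hz => ?_
    have hz' : Real.sqrt (2 * s₀) < ‖z‖ := by simpa [mem_closedBall, dist_zero_right] using hz
    have hz2 : 2 * s₀ < ‖z‖ ^ 2 := by
      have h0 := mul_self_lt_mul_self (Real.sqrt_nonneg (2 * s₀)) hz'
      rw [Real.mul_self_sqrt (by positivity)] at h0
      nlinarith
    have : (b : ℝ → ℝ) (‖z‖ ^ 2) = 0 := by
      apply ContDiffBump.zero_of_le_dist
      show s₀ / 2 ≤ dist (‖z‖ ^ 2) s₀
      rw [Real.dist_eq, abs_of_nonneg (by linarith)]
      linarith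
    simp [this]
  have hint : Integrable (fun y : EuclideanSpace ℝ (Fin 3) => b (‖y‖ ^ 2) * G (‖y‖ ^ 2) ^ 2) :=
    hFc.integrable_of_hasCompactSupport hFsupp
  have hae := (integral_eq_zero_iff_of_nonneg (fun y => hFnn y) hint).1 hint0
  have hzero : (fun y : EuclideanSpace ℝ (Fin 3) => b (‖y‖ ^ 2) * G (‖y‖ ^ 2) ^ 2) = fun _ => 0 :=
    (Continuous.ae_eq_iff_eq volume hFc continuous_const).1 hae
  -- evaluate at `y₀`: `b(s₀) = 1`
  have h1 : b (‖y₀‖ ^ 2) = 1 := by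
    apply ContDiffBump.one_of_mem_closedBall
    show dist (‖y₀‖ ^ 2) s₀ ≤ s₀ / 4
    rw [hs₀, dist_self]; positivity
  have := congrFun hzero y₀
  simp only [h1, one_mul] at this
  have hG0 : G (‖y₀‖ ^ 2) = 0 := pow_eq_zero_iff two_ne_zero |>.1 this
  rw [hmG, hG0]

/-! ### The stub -/

/-- **Stub (a) `stub_sphericalMomentumDegenerate` of LINE «jet rigidity» (crux 27585), proved**: a smooth
divergence-free field, unthreaded about `x₀`, whose radial momentum about `x₀` is spherically symmetric,
vanishes identically (flux ⇒ sphere-tangential; then the tree's kinematic rigidity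
`eq_zero_of_tangential_divFree_radialCurlFree`). [folklore; cite: Backus1958, §2] -/
theorem stub_sphericalMomentumDegenerate : StubSphericalMomentumDegenerate := by
  intro w x₀ hw hdiv hcurl hsym x
  -- translate to the origin
  set w₀ : EuclideanSpace ℝ (Fin 3) → EuclideanSpace ℝ (Fin 3) := fun y => w (y + x₀) with hw₀
  have hw2 : ContDiff ℝ 2 w := hw.of_le (by norm_cast)
  have hw₀s : ContDiff ℝ 2 w₀ := hw2.comp (contDiff_id.add contDiff_const)
  -- `div` and `curl` commute with translations (`fderiv_comp_add_right`)
  have hdiv₀ : ∀ y, VectorCalculus.divergence w₀ y = 0 := fun y => by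
    simp only [hw₀, VectorCalculus.divergence, fderiv_comp_add_right]
    exact hdiv _
  have hcurl₀ : ∀ y, ⟪curl w₀ y, y⟫ = 0 := fun y => by
    have e : curl w₀ y = curl w (y + x₀) := by
      simp only [hw₀, curl, fderiv_comp_add_right]
    have := hcurl (y + x₀)
    rwa [add_sub_cancel_right, ← e] at this
  have hsym₀ : ∀ y y' : EuclideanSpace ℝ (Fin 3), ‖y‖ = ‖y'‖ → ⟪w₀ y, y⟫ = ⟪w₀ y', y'⟫ := by
    intro y y' hyy
    have := hsym (y + x₀) (y' + x₀) (by simpa using hyy)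
    simpa [hw₀] using this
  have htan₀ : ∀ y, ⟪w₀ y, y⟫ = 0 :=
    inner_self_eq_zero_of_spherical (hw₀s.of_le one_le_two) hdiv₀ hsym₀
  have h0 : w₀ = 0 := eq_zero_of_tangential_divFree_radialCurlFree hw₀s htan₀ hdiv₀ hcurl₀
  have := congrFun h0 (x - x₀)
  simpa [hw₀] using this

end Summit.NavierStokesRegularity.NavierStokesRegularity.Cruxes.UnthreadedRigidity.JetRigidity

end
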